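import Summits.HodgeConjecture.HodgeConjecture.Theorems.K2E1bCDPseudoCoeffOfParts      -- ★ p857662 «OfParts» leaf (K2E1b-plan (g4) cand ba1d7dc958782a35, filed K2-defs1 (g4)): the four `…Stmt` defs + PROVED `cdPseudoCoeffWith_of_parts` (+ ★ p857636 Defs leaf `K2E1bCDPseudoCoeffDefs`: `HasFinRankOpTrace`, `IsLeftKFiniteU21`, `hasArchOpTrace_unique`)
import Summits.HodgeConjecture.HodgeConjecture.Theorems.K2E1bFiniteRankArchOpTrace    -- ★ p857666 brick «8a-1» (K2-defs1 (g4)): heads (H1) `hasArchOpTrace_of_hasFinRankOpTrace`, (H2) `exists_hasFinRankOpTrace_of_isLeftKFiniteU21` — pay U8e-1 ∕ U8e-2 BY NAME at birth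
import Summits.HodgeConjecture.HodgeConjecture.Theorems.K2E1bGlobalizationCohUnitary    -- ★ p857716 «8a-4» (K2-defs1 (g4)): head `globalizationCohUnitary : GlobalizationCohUnitaryStmt` — pays U8e-4 BY NAME (ED. 2)
import HarnessLib

/-!
# K2 ∕ E1b tier 1 · unit U8e «CD PSEUDO-COEFFICIENT PARTS» — `Cruxes/H413/Lines/K2_E1b_GKCohomologyU21_U8e_CDPseudoCoeffParts.lean` (ED. 2)

Cell hodgecm-mathlib, Track B «K2-LIT», ENGINE E1b; crux item h413 = stmt-HodgeConjecture-24833; route `route-HodgeConjecture-HCCMUnconditional`;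
dealer ∕ line author K2E1b-plan (g4), by K2-lead (g1) CHAIR RULING R19 «8a IN-HOUSE PARTS (LIMITED)» (2026-09-04T05:10:13Z, `K2/STATUS.md`).
Parent: unit U8d `Lines/K2_E1b_GKCohomologyU21_U8d_CDPseudoCoeff.lean` (ED. 6, commit a896e17ad0ce), whose ONLY open critical socket is
8a `sig_K2E1bCDPseudoCoefficient : CDPseudoCoeffWith dsCarriersOfRecord levelBPin` (XL, LETTER-grade: the Clozel–Delorme pseudo-coefficient of the record cell with
χ-support) — the last open socket on the live cone of U8-1 `sig_K2E1bArchPacketSigns` (socket of record, 0-sorry BY NAME over U8d).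

WHAT THIS UNIT DOES (R19 (2), HONEST).  It CUTS 8a into ONE residual socket typed in the SHAPE OF THE PRINTED THEOREM (U8e-3, XL letter-grade, ONE named printed
input [ClozelDelorme1990, Thm. 1 ⇒ Cor.]) and three IN-HOUSE parts (U8e-1 M−, U8e-2 M, U8e-4 S–M, ★-adjacent), with the assembly `cdPseudoCoeffWith_of_parts` ALREADY ★
(kernel-checked in the «OfParts» leaf) and the head `cdPseudoCoefficient_of_sigs` below a 0-sorry TERM over the four socket NAMES.  It ISOLATES the XL core; it does NOT
remove it: U8-1 stays OPEN at 8a ∕ U8e-3 and no digit of the count moves until U8e-3 is paid.  U8d ED. 7 pays `sig_K2E1bCDPseudoCoefficient := cdPseudoCoefficient_of_sigs`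
BY NAME (the conclusion below is `CDPseudoCoeffWith dsCarriersOfRecord ‹levelBPin written out›`; U8d's `def levelBPin` has exactly that body, `δ`-unfolding) ONLY WHEN ALL
FOUR PARTS ARE ★ (R19 (1)) — until then 8a keeps its own `sorry` and this unit is a typed plan with a checked assembly.

THE PRINTED THEOREM (audited against the HELD pages of CD90 = `paper:doi-10-24033-asens-1602`, Clozel–Delorme, Ann. sci. ÉNS 23 (1990) 193–228; R19 said «NOT held» —
it IS held, 37 pp. materialised, no `lit want` needed):
* §1 p. 194 (p0003.txt L15–16): «Notons C_c^∞(G, K) l'espace des fonctions C^∞ à support compact K-finies à droite et à gauche sur G.»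
* Cor. p. 213 (p0022.txt L5–9): «COROLLAIRE (Existence de pseudo-coefficients). — Soit δ₀ ∈ Ĝ_d. Alors, pour tout r > 0, il existe f ∈ C_c^∞(G, K)_r telle que (i) tr δ₀(f) = 1
  (ii) tr π_{δ,ν}(f) = 0 pour toute représentation basique π_{δ,ν} de G différente de δ₀. Une fonction f satisfaisant ces conditions est appelée pseudo-coefficient de δ₀.»
* §5.2 p. 212 (p0021.txt L27–30): «si une représentation irréductible π de G s'exprime comme π = Σ n(δ, ν) π_{δ,ν} (égalité dans R(G)) avec les π_{δ,ν} basiques, les π_{δ,ν}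
  telles que n(δ, ν) ≠ 0 ont même caractère infinitésimal que π» — so `tr σ(f) ≠ 0` for an irreducible unitary `σ` forces inf. char.`(σ)` = inf. char.`(δ₀)` = that of
  `F_{φ(a,b,c)}` (`U(2,1)` has compact centre, the setting of §5.2; [Rogawski1990, §13.8 p. 218] uses exactly this).
Secondary reader: [White2012] = `paper:arxiv-1106.1127` §5, Lemma 5.23 (pseudo-coefficients `f_π`, «if Tr σ(f_π) ≠ 0 … the infinitesimal characters of σ and π are equal»,
quoted in U8d's module docstring from p0016).

TABLE (sockets of this unit; sizes; payers BY NAME; all statements are the ★ `def … : Prop`s of the «OfParts» leaf, token for token):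
| row   | socket                                   | statement (★ def)                 | size | payer ∕ status at ED. 1                                                                 |
|-------|------------------------------------------|-----------------------------------|------|------------------------------------------------------------------------------------------|
| U8e-1 | `sig_K2E1bFinRankTraceHasArchOpTrace`    | `FinRankTraceHasArchOpTraceStmt`  | M−   | ★ PAID BY NAME at birth — brick «8a-1» ★ p857666 `Theorems/K2E1bFiniteRankArchOpTrace.lean` (K2-defs1 (g4)), head (H1) `hasArchOpTrace_of_hasFinRankOpTrace` |
| U8e-2 | `sig_K2E1bLeftKFiniteFinRank`            | `LeftKFiniteFinRankStmt`          | M    | ★ PAID BY NAME at birth — same brick ★ p857666, head (H2) `exists_hasFinRankOpTrace_of_isLeftKFiniteU21` (verbatim) |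
| U8e-3 | `sig_K2E1bCDPseudoCoefficientCore`       | `CDPseudoCoeffCoreStmt`           | XL   | OPEN — LETTER-grade residual, ONE named printed input [ClozelDelorme1990, Thm. 1 ⇒ Cor.]   |
| U8e-4 | `sig_K2E1bGlobalizationCohUnitary`       | `GlobalizationCohUnitaryStmt`     | S–M  | ★ PAID BY NAME (ED. 2, 05:55Z) — «8a-4» ★ p857716 `Theorems/K2E1bGlobalizationCohUnitary.lean` (K2-defs1 (g4)), head `globalizationCohUnitary` |
| head  | `cdPseudoCoefficient_of_sigs`            | `CDPseudoCoeffWith dsCarriersOfRecord ‹levelBPin›` | — | 0-sorry TERM `cdPseudoCoeffWith_of_parts sig₁ sig₂ sig₃ sig₄` (★ composition)   |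
PRICE after ED. 2: live cone of U8-1 = {8a} ≡ {U8e-3} ∪ ★ {U8e-1, U8e-2, U8e-4} — THE PRINTED THEOREM ITSELF is the only open statement on the E1b line's archimedean cone;
critical-open count of the E1b line unchanged (8a is ONE socket until ED. 7, which now waits on U8e-3 alone).

DEPENDENCY MAP.  ★ Defs leaf `K2E1bCDPseudoCoeffDefs` (`HasFinRankOpTrace`, `IsLeftKFiniteU21`, `hasArchOpTrace_unique`) ← ★ U8 defs leaf `K2E1bArchPacketSignsDefs`
(`HasArchOpTrace`, `IsArchTestU21`, `IsRegularParam`, `casimirOf`, `centralOf`) ; ★ «OfParts» leaf `K2E1bCDPseudoCoeffOfParts` (the four `…Stmt`, `cdPseudoCoeffWith_of_parts`)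
← ★ Q11 `K2E1bArchPacketSignsOfParts` (`CDPseudoCoeffWith`), ★ D-U8-1 `K2E1bCubicCasimirDefs` (`SameCubicPin`), ★ Q9c `K2E1bDSClsOfRecord` (`dsClsOfRecord`, `dsCarriersOfRecord`),
★ Q12 `K2E1bUnitaryDualOfParts` (`HasChiScalars.of_mk_eq_mk`), ★ `K2E1bGKCohomologyU21Defs` (`IsChiPinnedCohUnitary`, `HasChiScalars`), ★ `F0P3bArchDegOnePackageDefs` (`IsCohUnitaryIrrep`).
QUANTIFIER CHOICE (R19 (3)): 8a stays AS TYPED — «every unitary globalization» is printed-shaped (`tr π(f)` is a class function; ★ `archOpTrace_eq_of_isUnitaryGlobalization`,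
Harish-Chandra Thm. 8, is the transport); NO R8-twin.

HONEST LABEL: HC_CM is proved only modulo the 7 printed citations (2 remaining named inputs: hLiu418 = stmt-HodgeConjecture-24832,
h413 = stmt-HodgeConjecture-24833) until rung 0 closes; this unit hosts three ★-paid sockets (U8e-1, U8e-2, U8e-4), ONE sorried socket (U8e-3 = the printed theorem) and one 0-sorry head; it
isolates the XL core of 8a as ONE printed-shape socket (U8e-3) and does not remove it; count-neutral.
-/

set_option autoImplicit false
set_option linter.dupNamespace false

noncomputable section

open NumberField MeasureTheory CompactlySupported
open scoped Matrix MatrixGroups InnerProductSpace ENNReal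

namespace Summit.HodgeConjecture.HodgeConjecture.Cruxes.H413.K2E1bGKCohomologyU21.U8

open Literature.NumberTheory.Automorphic
open Literature.RepresentationTheory.KonnoKonno2007 Literature.RepresentationTheory.KonnoKonno2007.RealDualPair
open Summit.HodgeConjecture.HodgeConjecture.Cruxes.H413.K2E1bGKCohomologyU21 (IsChiPinnedCohUnitary SameCubicPin)
open Summit.HodgeConjecture.HodgeConjecture.Cruxes.H413.K2E1bDSClsOfRecord (dsClsOfRecord dsCarriersOfRecord)

/-! ## §1 The four sockets of socket 8a (statement bytes frozen at hosting; U8e-1 ∕ U8e-2 paid BY NAME at birth, U8e-4 at ED. 2; U8e-3 open) -/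

/-- **SOCKET U8e-1 `sig_K2E1bFinRankTraceHasArchOpTrace` (M−, pure Hilbert space) — FINITE-RANK TRACE ⇒ BASIS-FREE TRACE.**  If `ϖ(f)` has finite rank with
finite-rank trace `c` (★ `HasFinRankOpTrace`: some finite-dimensional `W ⊇ range ϖ(f)`, `tr (ϖ(f)|_W) = c`), then `Σ_k ⟪e_k, ϖ(f) e_k⟫ → c` along EVERY Hilbert basis
(★ `HasArchOpTrace`): expand `ϖ(f) e_k ∈ W` in an orthonormal basis of `W`, Parseval (Mathlib `HilbertBasis.hasSum_inner_mul_inner`), `LinearMap.trace_eq_sum_inner`.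
★ PAID BY NAME at birth: brick «8a-1» ★ p857666 `Theorems/K2E1bFiniteRankArchOpTrace.lean` (K2-defs1 (g4)), head (H1) `hasArchOpTrace_of_hasFinRankOpTrace` (generic `G`, `E`;
`--axioms` TRIO), instantiated at `U(2,1)` under the statement's binders. [cite: Knapp1986, Thm. 10.2] -/
theorem sig_K2E1bFinRankTraceHasArchOpTrace : FinRankTraceHasArchOpTraceStmt := by
  intro _ _ ν _ E _ _ _ ϖ hu hsc f c h
  exact hasArchOpTrace_of_hasFinRankOpTrace ν ϖ hu hsc f h

/-- **SOCKET U8e-2 `sig_K2E1bLeftKFiniteFinRank` (M) — LEFT-`K`-FINITE TEST FUNCTION ⇒ `ϖ(f)` HAS FINITE RANK** on every unitary globalization `ϖ` of a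
`(𝔤,K)`-class `x` of `U(2,1)`: `ϖ(λ(k) f) = ϖ(k) ϖ(f)` (left-invariant Haar `ν`), so `φ ↦ ϖ(φ) v` is a `K`-map from the finite-dimensional span of the left translates
of `f` to `ϖ|_K`, whence `range ϖ(f)` lies in finitely many `K`-isotypic parts, each finite-dimensional by admissibility of the globalization (★ `kTypeGrowth_uTwoOne` +
★ E1 `finiteDimensional_homRangeSum_of_admissible`).  ★ PAID BY NAME at birth: brick «8a-1» ★ p857666, head (H2) `exists_hasFinRankOpTrace_of_isLeftKFiniteU21` (statement
verbatim; `--axioms` TRIO). [cite: BorelWallach2000, 0 §2.5] [cite: Knapp1986, Thm. 10.2] -/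
theorem sig_K2E1bLeftKFiniteFinRank : LeftKFiniteFinRankStmt :=
  exists_hasFinRankOpTrace_of_isLeftKFiniteU21

/-- **SOCKET U8e-3 `sig_K2E1bCDPseudoCoefficientCore` (XL, LETTER-grade — THE residual of 8a, ONE named printed input) — THE CLOZEL–DELORME PSEUDO-COEFFICIENT OF THE
RECORD CELL IN PRINTED SHAPE.**  For every Haar measure `ν` on `U(2,1)`, regular `(a,b,c)` and `j : Fin 3` there is `f ∈ C_c^∞(U(2,1))` (★ `IsArchTestU21`), LEFT-`K`-finite
(★ `IsLeftKFiniteU21`; print gives bi-`K`-finite), with (i) finite-rank trace `δ_{ij}` (★ `HasFinRankOpTrace`) on every unitary globalization of the record cell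
`dsClsOfRecord a b c i` («tr δ₀(f) = 1», «tr π_{δ,ν}(f) = 0 pour toute représentation basique … différente de δ₀» — the three cells are discrete series, i.e. basic, and
distinct: ★ `lawDistinct_dsCarriersOfRecord`), and (ii) a NON-ZERO finite-rank trace on a unitary globalization of a class `x` only if `x` has the infinitesimal character
of `F_{φ(a,b,c)}` — χ-pins `(casimirOf a b c, centralOf a b c)` on some representative (degrees 1, 2 of `Z(𝔤𝔩₃)`; the cells carry them by ★ `lawChi_dsCarriersOfRecord`) and
the cubic pin of `dsClsOfRecord a b c j` (degree 3, RELATIVE, ★ `SameCubicPin`) («même caractère infinitésimal», §5.2 p. 212).  QUOTES: module docstring (p0003 L15–16,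
p0021 L27–30, p0022 L5–9 of `paper:doi-10-24033-asens-1602`).  Road for a payer (XL): Clozel–Delorme Thm. 1 (invariant Paley–Wiener for `K`-finite functions) ⇒ Cor.;
or Rogawski's use of it [Rogawski1990, §13.8 p. 218].  Why it might fail: only by a typing slip — print's `K` vs ★ `maximalCompact` (`U(2,1) ∩ U(3)`, = `U(2) × U(1)`,
print's `K`), or the `δ`-normalisation `tr δ₀(f) = 1` vs a Haar-measure convention (absorbed: `ν` is quantified and `f` may depend on it).
[cite: ClozelDelorme1990, Prop. 4, Corollaire] [cite: Rogawski1990, §13.8 p. 218] [cite: KnappVogan1995, Prop. 4.120] -/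
theorem sig_K2E1bCDPseudoCoefficientCore : CDPseudoCoeffCoreStmt := by
  sorry

/-- **SOCKET U8e-4 `sig_K2E1bGlobalizationCohUnitary` (S–M, ★-adjacent) — A GLOBALIZED CLASS IS COH-UNITARY.**  If the `(𝔤,K)`-class `x` of `U(2,1)` has a unitary
globalization `ϖ` (★ `IsUnitaryGlobalization`), some representative of `x` is an irreducible ADMISSIBLE `(𝔲(2,1),K)`-module unitary along `𝔭 ⊕ ℝz₀` (★ `IsCohUnitaryIrrep`):
the Harish-Chandra module of `ϖ` is infinitesimally unitary (★ `isInfUnitary_harishChandra`), hence unitary along `𝔭 ⊕ ℝz₀` (★ `stubT3aUnitaryAlongPOfHermitian_holds`),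
admissible (★ `kTypeGrowth_uTwoOne`), irreducible (★ `isIrreducibleGK_harishChandra_of_isAdmissibleGK` or the `AreGKEquivalent` with the irreducible representative), and
these transport along the `(𝔤,K)`-equivalence to a representative of `x` (or: take the Harish-Chandra module itself as the representative, ★ `GKIrrClass.mk_eq_mk_iff`).
Precedent: ★ `isUnitaryGlobalization_clInfChoiceU_of_archIsotypy` (F0P3).  ★ PAID BY NAME (ED. 2): deal «8a-4» ★ p857716 `Theorems/K2E1bGlobalizationCohUnitary.lean`
(K2-defs1 (g4)), head `globalizationCohUnitary` (statement verbatim; `--axioms` TRIO). [cite: BorelWallach2000, 0 §2.5] [cite: Rogawski1990, Prop. 13.8.1 p. 206] -/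
theorem sig_K2E1bGlobalizationCohUnitary : GlobalizationCohUnitaryStmt :=
  globalizationCohUnitary

/-! ## §2 The head (0-sorry term over the four socket names; U8d ED. 7 pays 8a with it BY NAME once U8e-3 is ★ too) -/

/-- **HEAD `cdPseudoCoefficient_of_sigs` — SOCKET 8a's STATEMENT (U8d's `levelBPin` written out) FROM THE FOUR SOCKETS, by the ★ composition `cdPseudoCoeffWith_of_parts`.**
[cite: ClozelDelorme1990, Prop. 4, Corollaire] [cite: Knapp1986, Thm. 10.2] [cite: KnappVogan1995, Prop. 4.120] -/
theorem cdPseudoCoefficient_of_sigs :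
    CDPseudoCoeffWith dsCarriersOfRecord
      (fun a b c j x => IsChiPinnedCohUnitary x (casimirOf a b c) (centralOf a b c) ∧ SameCubicPin x (dsClsOfRecord a b c j)) :=
  cdPseudoCoeffWith_of_parts sig_K2E1bFinRankTraceHasArchOpTrace sig_K2E1bLeftKFiniteFinRank sig_K2E1bCDPseudoCoefficientCore
    sig_K2E1bGlobalizationCohUnitary

end Summit.HodgeConjecture.HodgeConjecture.Cruxes.H413.K2E1bGKCohomologyU21.U8
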